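import Mathlib.Analysis.ODE.Gronwall
import Mathlib.Analysis.Calculus.ContDiff.RCLike
import Literature.Topology.FourManifolds.MMSWRasmussenFacts
import Summits.SmoothPoincare4.SmoothPoincare4.Theses.DottedCircleRasmussen

/-!
# Helper `helper_friendsCarrier_Vk_discFlowLines` (piece 6 of the registered helper `helper_friendsCarrier_Vk`,
stub `stub_friendsCarrier`, line `mk_friends`, skeleton v5) for crux `DcrGap`
(item stmt-SmoothPoincare4-16128, route route-SmoothPoincare4-DottedCircleRasmussen)

**In the adapted collar the slice disc is a product.**  Let `V` be a `C^∞` field on `ℝ⁴` vanishing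
outside a ball and tangent to the model slice disc `f₁` along the inward radial direction near its
boundary circle, `V(f₁(t u)) = -df₁(t u) u` for `|t - 1| < δ'` (the output of
`helper_friendsCarrier_Vk_adaptedField`), and let `Φ` be a flow of `V` (`∂_s Φ(s, x) = V(Φ(s, x))`,
`Φ(0, x) = x`; the output of `helper_friendsCarrier_Vk_clockFlow`).  Then the flow line issued from the
boundary point `f₁ u = K₁ u` IS the disc ray:

  `Φ(s, f₁ u) = f₁((1 - s) u)`   for `|s| < δ'`,

by uniqueness of integral curves (`V` is Lipschitz, being `C¹` with compact support; Mathlib's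
`ODE_solution_unique_of_mem_Ioo`), the ray `s ↦ f₁((1 - s) u)` being an integral curve by the tangency
and the chain rule.  So in the collar `M_k × (-2ε, 2ε) ≅ band` defined by `Φ` the disc is
`K₁ × [0, 2ε)` on the nose — the `k ≥ 1` replacement of the conical normal form `g₁(t u) = t K(u)` of
the `k = 0` template (`SliceDiscEndCollarFacts.lean`).

No definitions, no named facts, no `sorry`.

## References

* P. Hartman, *Ordinary Differential Equations* (1964), Ch. II Thm. 1.1 (uniqueness under a Lipschitz
  condition). [folklore]
-/

-- the prescribed namespace `Summit.<P>.<Sub>.…` duplicates `SmoothPoincare4` (P = Sub)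
set_option linter.dupNamespace false
set_option linter.style.longLine false

noncomputable section

open scoped Manifold ContDiff Topology NNReal
open Set Function Metric Filter
open Literature.Topology.FourManifolds Literature.Topology.FourManifolds.MMSW

namespace Summit.SmoothPoincare4.SmoothPoincare4.Theorems.DcrGap.MkFriends

namespace FriendsCarrierVk

/-- **The disc rays are the flow lines of a field tangent to the disc** (uniqueness of integral
curves). [folklore] -/
theorem flow_eq_disc_ray {f₁ : EuclideanSpace ℝ (Fin 2) → EuclideanSpace ℝ (Fin 4)}
    {V : EuclideanSpace ℝ (Fin 4) → EuclideanSpace ℝ (Fin 4)} {Φ : ℝ × EuclideanSpace ℝ (Fin 4) → EuclideanSpace ℝ (Fin 4)}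
    {δ' R : ℝ} (hf : ContDiff ℝ ∞ f₁) (hV : ContDiff ℝ ∞ V) (hVR : ∀ y, R ≤ ‖y‖ → V y = 0)
    (htan : ∀ (u : sphere (0 : EuclideanSpace ℝ (Fin 2)) 1) (t : ℝ), 1 - δ' < t → t < 1 + δ' →
      V (f₁ (t • (u : EuclideanSpace ℝ (Fin 2)))) = -(fderiv ℝ f₁ (t • (u : EuclideanSpace ℝ (Fin 2))) (u : EuclideanSpace ℝ (Fin 2))))
    (hΦ : ∀ x s, HasDerivAt (fun s : ℝ => Φ (s, x)) (V (Φ (s, x))) s) (hΦ0 : ∀ x, Φ (0, x) = x)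
    (u : sphere (0 : EuclideanSpace ℝ (Fin 2)) 1) {s : ℝ} (hs : |s| < δ') :
    Φ (s, f₁ (u : EuclideanSpace ℝ (Fin 2))) = f₁ ((1 - s) • (u : EuclideanSpace ℝ (Fin 2))) := by
  -- `V` is Lipschitz
  have hsupp : HasCompactSupport V := by
    refine HasCompactSupport.intro (isCompact_closedBall (0 : EuclideanSpace ℝ (Fin 4)) R) fun y hy => hVR y ?_
    rw [mem_closedBall, dist_zero_right, not_le] at hy
    exact hy.le
  obtain ⟨C, hC⟩ := hV.lipschitzWith_of_hasCompactSupport hsupp (by simp)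
  -- the two curves
  have hδ' : 0 < δ' := lt_of_le_of_lt (abs_nonneg s) hs
  set γ₂ : ℝ → EuclideanSpace ℝ (Fin 4) := fun σ => f₁ ((1 - σ) • (u : EuclideanSpace ℝ (Fin 2))) with hγ₂
  have hγ₂d : ∀ σ ∈ Ioo (-δ') δ', HasDerivAt γ₂ (V (γ₂ σ)) σ := by
    intro σ hσ
    have hline : HasDerivAt (fun σ : ℝ => (1 - σ) • (u : EuclideanSpace ℝ (Fin 2))) ((-1 : ℝ) • (u : EuclideanSpace ℝ (Fin 2))) σ := by
      simpa using ((hasDerivAt_id σ).const_sub 1).smul_const (u : EuclideanSpace ℝ (Fin 2))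
    have hfd : HasFDerivAt f₁ (fderiv ℝ f₁ ((1 - σ) • (u : EuclideanSpace ℝ (Fin 2)))) ((1 - σ) • (u : EuclideanSpace ℝ (Fin 2))) :=
      ((hf.differentiable (by simp)) _).hasFDerivAt
    have h := hfd.comp_hasDerivAt σ hline
    rw [map_smul, neg_one_smul, ← htan u (1 - σ) (by linarith [hσ.2]) (by linarith [hσ.1])] at h
    exact h
  have heq := ODE_solution_unique_of_mem_Ioo (v := fun _ y => V y) (s := fun _ => univ) (K := C)
    (f := fun σ => Φ (σ, f₁ (u : EuclideanSpace ℝ (Fin 2)))) (g := γ₂) (a := -δ') (b := δ') (t₀ := 0)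
    (fun _ _ => hC.lipschitzOnWith) ⟨by linarith, hδ'⟩
    (fun σ _ => ⟨hΦ _ σ, mem_univ _⟩) (fun σ hσ => ⟨hγ₂d σ hσ, mem_univ _⟩)
    (by simp [hγ₂, hΦ0])
  have hsI : s ∈ Ioo (-δ') δ' := by have := abs_lt.1 hs; exact ⟨this.1, this.2⟩
  exact heq hsI

end FriendsCarrierVk

open FriendsCarrierVk in
/-- **Helper `helper_friendsCarrier_Vk_discFlowLines`** (registered piece of `helper_friendsCarrier_Vk`: in the
adapted collar the disc is a product).  For a model slice disc `f₁`, a `C^∞` field `V` on `ℝ⁴` vanishing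
outside a ball and tangent to the disc along the inward rays near the boundary circle
(`V(f₁(t u)) = -df₁(t u) u` for `|t - 1| < δ'`), and any flow `Φ` of `V` (flow equation and
`Φ(0, x) = x`), the flow line from `f₁ u` is the ray: `Φ(s, f₁ u) = f₁((1 - s) u)` for `|s| < δ'`.
[folklore] -/
theorem helper_friendsCarrier_Vk_discFlowLines : ∀ (k : ℕ) (K₁ : (Metric.sphere (0 : EuclideanSpace ℝ (Fin 2)) 1) → EuclideanSpace ℝ (Fin 4)) (f₁ : EuclideanSpace ℝ (Fin 2) → EuclideanSpace ℝ (Fin 4)) (V : EuclideanSpace ℝ (Fin 4) → EuclideanSpace ℝ (Fin 4)) (Φ : ℝ × EuclideanSpace ℝ (Fin 4) → EuclideanSpace ℝ (Fin 4)) (R δ' : ℝ), Literature.Topology.FourManifolds.MMSW.IsModelSliceDisc k K₁ f₁ → ContDiff ℝ ((⊤ : ℕ∞) : WithTop ℕ∞) V → (∀ y, R ≤ ‖y‖ → V y = 0) → (∀ (u : (Metric.sphere (0 : EuclideanSpace ℝ (Fin 2)) 1)) (t : ℝ), 1 - δ' < t → t < 1 + δ' → V (f₁ (t • (u : EuclideanSpace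 ℝ (Fin 2)))) = -((fderiv ℝ f₁ (t • (u : EuclideanSpace ℝ (Fin 2)))) (u : EuclideanSpace ℝ (Fin 2)))) → (∀ x s, HasDerivAt (fun s : ℝ => Φ (s, x)) (V (Φ (s, x))) s) → (∀ x, Φ (0, x) = x) → ∀ (u : (Metric.sphere (0 : EuclideanSpace ℝ (Fin 2)) 1)) (s : ℝ), |s| < δ' → Φ (s, K₁ u) = f₁ ((1 - s) • (u : EuclideanSpace ℝ (Fin 2))) := by
  intro k K₁ f₁ V Φ R δ' hf hV hVR htan hΦ hΦ0 u s hs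
  rw [← hf.apply_sphere u]
  exact flow_eq_disc_ray (contMDiff_iff_contDiff.1 hf.1) hV hVR htan hΦ hΦ0 u hs

end Summit.SmoothPoincare4.SmoothPoincare4.Theorems.DcrGap.MkFriends

end
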